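import Literature.NumberTheory.Sieve.LinearEquationsInPrimesLevelTwoInterface
import Literature.NumberTheory.Sieve.LinearEquationsInPrimesComplexityNormalForm
import HarnessLib

/-!
# Linear equations in primes, level 2: `GI(2)` and `MN(2)` give the Main Theorem for every system of complexity at most two

Topic `Literature/NumberTheory/Sieve`. Proved certificates, no definitions, no named facts: the
composition of the level-2 interface (`GreenTao2010_gowersUniformityAt_two_of_GI_of_MN`: the two
deep inputs `GITwo` — the `U³[N]` inverse theorem on the Heisenberg class — and `MNTwo` — Möbius
orthogonal to 2-step nilsequences — give Thm. 7.2 at `s = 2`, the metric and (12.6)₂ being theorems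
of the tree) with §4 of Green–Tao 2010 at the TRUE complexity
(`GreenTao2010_mainTheoremAtComplexity_two_of_gowersUniformityAt_two`,
`LinearEquationsInPrimesComplexityNormalForm.lean`). The payoff of `GITwo ∧ MNTwo` is thereby the
Main Theorem for EVERY nondegenerate system of Cauchy–Schwarz complexity `≤ 2` — four-term
progressions of primes, three-dimensional prime cubes (`d = 4`, `t = 8`, Example 2), `IP₀` cubes
with `d = 3` (`t = 7`, Example 3), … — and not only for systems of `t ≤ 4` forms
(`GreenTao2010_mainTheorem_of_le_four_of_GI_of_MN`, which is recovered: Lemma 1.6).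

## References

* [GreenTao2010] B. Green, T. Tao, *Linear equations in primes*, Ann. of Math. 171 (2010),
  1753–1850: Main Theorem, Def. 1.5, Lemma 1.6, Examples 1–3, Thm. 7.2, Prop. 8.4, Conj. 8.5
  (case `s = 2`).
-/

noncomputable section

namespace Literature.NumberTheory.Sieve

open GreenTaoLevelTwo in
/-- **The level-2 rung for all systems of complexity `≤ 2`**: `GI(2)` and `MN(2)` on the
Heisenberg class give the Main Theorem of Green–Tao 2010 for every nondegenerate system of
affine-linear forms of complexity at most `2`, in any number of forms and variables.
[cite: GreenTao2010, Main Theorem, Thm. 7.2 (case `s = 2`) and §4] -/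
theorem GreenTao2010_mainTheoremAtComplexity_two_of_GI_of_MN (hGI : GITwo) (hMN : MNTwo) :
    GreenTao2010_mainTheoremAtComplexity 2 :=
  GreenTao2010_mainTheoremAtComplexity_two_of_gowersUniformityAt_two
    (GreenTao2010_gowersUniformityAt_two_of_GI_of_MN hGI hMN)

open GreenTaoLevelTwo in
/-- The level-2 statement for all systems of complexity `≤ 2` contains the `t ≤ 4` statement
`MainTheoremLeFour`: a system of `t ≤ 4` forms with no two linear parts parallel and no constant
form has complexity `≤ t − 2 ≤ 2` (Lemma 1.6, `complexity_le_of_isFiniteComplexitySystem`).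
[cite: GreenTao2010, Lemma 1.6] -/
theorem GreenTaoLevelTwo.mainTheoremLeFour_of_mainTheoremAtComplexity_two
    (h : GreenTao2010_mainTheoremAtComplexity 2) : MainTheoremLeFour := by
  intro d t L hd ht ht4 ε hε
  obtain ⟨N₀, hN₀⟩ := h d t L hd ht ε hε
  refine ⟨N₀, fun N hN Ψ hΨ hfc hL K hK hKN => hN₀ N hN Ψ hΨ ?_ hL K hK hKN⟩
  have ht2 : t - 2 ≤ 2 := by omega
  exact (complexity_le_of_isFiniteComplexitySystem hfc hΨ.1).trans (by exact_mod_cast ht2)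

/-- Every level `s ≤ 2` (complexity `0`, `1`, `2`) from `GI(2)` and `MN(2)`; the levels `≤ 1`
are unconditional (`GreenTao2010_mainTheoremAtComplexity_one`).
[cite: GreenTao2010, Main Theorem and Thm. 7.2] -/
theorem GreenTao2010_mainTheoremAtComplexity_of_le_two_of_GI_of_MN
    (hGI : GreenTaoLevelTwo.GITwo) (hMN : GreenTaoLevelTwo.MNTwo) {s : ℕ} (hs : s ≤ 2) :
    GreenTao2010_mainTheoremAtComplexity s :=
  (GreenTao2010_mainTheoremAtComplexity_two_of_GI_of_MN hGI hMN).anti hs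

end Literature.NumberTheory.Sieve

end
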